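import Literature.MathematicalPhysics.QuantumFieldTheory.Balaban1983to89.B9RWSums347DefiniteFaces

/-!
# `Balaban1983to89.B9RWSums347DefiniteFacesWindow` — [4] Lemma 2.1 (2.60)∕(2.61) ON A RATE WINDOW, supplied to rows 13 ∕ 18 ∕ 19
# of the N06 knit: ONE exponent and ONE M-threshold for every rate pair (δ, α) of a closed-below window, from the record schema
# `RowSum261` («antitone in the rate»); the exponent ∕ threshold as FUNCTIONS of the rate for the window open at 0; at def-Y's
# members `geo9Y` BY NAME

T. Bałaban, *Propagators and renormalization transformations for lattice gauge theories. II*, Commun. Math. Phys. **96** (1984)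
223–250 [`Balaban1984PropagatorsII`, "[4]"], Lemma 2.1 p. 234: *"e^{−αδ₀d(y,y′)} ≤ e^{−αδ₀RM max{|j−j′|−1,0}}, y ∈ Λ_j, y′ ∈ Λ_{j′},
(2.60) … sup_{y∈𝔅} Σ_{y′∈𝔅} e^{−αδ₀d(y,y′)} ≤ c₁(α), (2.61)"* with *"c₁(α) = 12c₀^d(½α)"*, c₀(α) = Σ_{z∈ℤ} e^{−αδ₀|z|} (p. 233), for
*"RM satisfying (2.59)"*; consumed by T. Bałaban, *Propagators for lattice gauge theories in a background field*, Commun. Math. Phys.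
**99** (1985) 389–434 [`Balaban1985BackgroundPropagators`, "B9"], Sect. B–C (Cor. 3.6, Thm 3.7, Thm 3.10: the random-walk sums and the
(3.42) ⇒ (3.47) passage, p. 398 *"consequences of the local ones (3.42) and Lemma 2.1"*).

statement-level skeleton of published theorems with citation tags; proofs where landed; nothing here is a claim about the
Yang–Mills mass gap

WHY THIS FILE (sibling of `B9RWSums347DefiniteFaces`, which supplies (2.61) at ONE rate pair through the definite door exponent
`exp261 geo δ₀ α`).  The row-13 frames of the N06 knit are being re-typed («frames v2», seat `pub-ymgap-dag-n06-c` gen 4) with the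
Lemma-2.1 fields M-THRESHOLDED AND RATE-CAPPED — of the shape `∀ i δ α, δ in a window → α in a window → M261 δ ≦ (geo i).M →
Ineq261 dB (toB6 (geo i) (R i) (H i)) δ α` — to be discharged at the record *"from `rowSum261_geo9Y` (antitone in the rate ⇒ one
exponent ∕ threshold per capped rate window)"*.  This file makes that remark a theorem, in three currencies, and adds the p. 398 scale transfers the same frames display:

* §1 arithmetic of the printed constant on a window: `c0_anti` (c₀ is antitone in the rate product: 0 < aδ ≦ a′δ′ ⇒ c₀(δ′, a′) ≦
  c₀(δ, a)), `c1_window_le` (for 0 < δ ≦ δhi, 0 < α ≦ 1: c₁(d′, δhi, 1) ≦ c₁(d′, δ, α) — the corner (δhi, 1) of the window minimises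
  c₁ = 12c₀(½α)^{d′}).
* §2 over a family `geo : I → B9.Geometry` with the record schema `RowSum261 geo` and `d ≧ 0`: `ineq261With_window_of_rowSum261` —
  ONE threshold and the ONE definite constant `rowConst261 geo κlo` serve EVERY rate pair with κlo ≦ αδ (termwise monotonicity of
  e^{−αδd}); ★ `ineq261_window_of_rowSum261` — in PRINTED shape, ONE exponent `dB` and ONE threshold for the closed-below window
  δlo ≦ δ ≦ δhi, αlo ≦ α ≦ 1 (n06-j's door `exists_le_c1` at the corner + §1); ★ `ineq261_fn_of_rowSum261` — for the window OPEN at 0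
  the exponent and the threshold as FUNCTIONS of the rate, `∃ (d261 : ℝ → ℕ) (M261 : ℝ → ℝ), ∀ i δ α, 0 < δ → αlo ≦ α → α ≦ 1 →
  M261 δ ≦ (geo i).M → Ineq261 (d261 δ) (toB6 (geo i) (R i) (H i)) δ α` (by choice over the one-rate windows).  A FIXED exponent
  on the window open at 0 is NOT claimed: it would need the explicit rate dependence of the family's row-sum constant, which the
  schema `RowSum261` (a generic ∃-constant per rate) does not carry.
* §3 at def-Y's members (`geo9Y x = geo9K x.toKIdx`), ZERO hypotheses about the geometry (n06-i's `rowSum261_geo9Y`,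
  `geo9K_dist_nonneg'`, `levelGap_geo9Y` BY NAME): `geo9Y_dist_nonneg`, ★ `ineq261With_window_geo9Y`, ★★ `ineq261_window_geo9Y`,
  ★★ `ineq261_fn_geo9Y`; (2.60) THRESHOLD-FREE at every rate product ≧ 0 and every transport letter R ≦ 2L² − 1
  (`ineq260_geo9Y_all`); ★★ `lemma21Window_geo9Y` — (2.60) ∧ (2.61) on the closed window under one threshold, R read as 1.
* §4 the p. 398 SCALE TRANSFERS (*"Using Lemma 2.1 in [4] we may replace the factor (Lʲη)^α by (Lʲη)^β(L^{j′}η)^γ"*) on a rate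
  window at `geo9Y` — unlike (2.60) itself they need the located size condition |q|·log L ≦ αδ·RM, i.e. ONE threshold
  `4·log(ℓ+1)∕κlo` per floor rate κlo ≦ αδ for all powers |q| ≦ 4: `scaleTransfer_rpow_geo9Y` (n06-i's `transferL_geo9K`),
  `scaleTransfer_rpow_window_geo9Y` (ONE constant (ℓ+1)⁴), ★★ `scaleTransfer6_window_geo9Y` — the row-13 frames' six transfers
  (weights Lʲη, (Lʲη)², (Lʲη)⁻¹, (Lʲη)⁻², (Lʲη)⁻⁴, (Lʲη)^{−4}) VERBATIM at `geo9Y x` with constant (ℓ+1)⁴; ★★ `lemma21Fields_window_geo9Y`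
  — BOTH frame fields ((2.61) in printed shape + the six transfers) on a closed-below window under ONE exponent and ONE threshold.
* §5 (v1.1) the row-13 frames' v2.1 fields VERBATIM at `geo9Y`: ★★ `h261_frameV21_geo9Y` (αlo := 9∕5000, any cap), ★★ `hST_frameV21_geo9Y`
  (`Λf := (ℓ+1)⁴`, `MST δ := 4·log(ℓ+1)∕((9∕5000)δ)`).

HONEST SCOPE.  Kernel bookkeeping over landed modules ([4] Lemma 2.1 consumed from the record schemas, theorems at `geo9Y`); the
constants `rowConst261 geo κlo`, `c₁(dB, …)` are α-dependent O(1)'s by choice, NOT print's c₁(α) (refuted as typed for d ≧ 3,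
`B6Lemma21Counterexample`).  NOT a node discharge; count-neutral; one finite 𝕋^{d+1} programme at fixed ε — nothing continuum,
nothing about the mass gap.  Cell `pub-ymgap` (HUMAN RULING D-0062), Track A node N06 [B9], N06-ASSIGNMENT v1 bundle F6 (rows 18–19),
seat `pub-ymgap-dag-n06-k` (gen 5), 2026-08-27.
-/

noncomputable section

namespace Literature.MathematicalPhysics.QuantumFieldTheory.Balaban1983to89.B9RWSums347DefiniteFacesWindow

open Literature.MathematicalPhysics.QuantumFieldTheory.Balaban1983to89
open Finset B6RandomWalk B9Thm34Ext B9RowSum261Faces B9RowSum261DefiniteFaces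
open B6Lemma21Repaired B9Ineq349Whole B9PinMembersKLevelV1 B9GeoLemma21KLevelV1

/-! ## §1 The printed constant on a rate window -/

section Arith

/-- **c₀ is antitone in the rate product**: for 0 < aδ ≦ a′δ′, `c₀(δ′, a′) = Σ_z e^{−a′δ′|z|} ≦ Σ_z e^{−aδ|z|} = c₀(δ, a)` (termwise,
both series summable). [cite: Balaban1984PropagatorsII, p.233 (c₀(α) definition)] -/
theorem c0_anti {δ a δ' a' : ℝ} (h : 0 < a * δ) (hle : a * δ ≤ a' * δ') : B6.c0 δ' a' ≤ B6.c0 δ a := by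
  unfold B6.c0
  have hs := B6Lemma21Arith.summable_c0_term h
  have hs' := B6Lemma21Arith.summable_c0_term (lt_of_lt_of_le h hle)
  refine hs'.tsum_le_tsum (fun z => ?_) hs
  rw [Real.exp_le_exp]
  have hz : 0 ≤ |(z : ℝ)| := abs_nonneg _
  nlinarith

/-- **The corner (δhi, 1) of the window minimises c₁**: for 0 < δ ≦ δhi and 0 < α ≦ 1, `c₁(d′, δhi, 1) = 12c₀(δhi, ½)^{d′} ≦
12c₀(δ, ½α)^{d′} = c₁(d′, δ, α)` (§1 `c0_anti` with ½αδ ≦ ½δhi, c₀ ≧ 0). [cite: Balaban1984PropagatorsII, Lemma 2.1 p.234 (c₁(α) = 12c₀^d(½α))] -/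
theorem c1_window_le (dB : ℕ) {δ α δhi : ℝ} (hδ : 0 < δ) (hδhi : δ ≤ δhi) (hα : 0 < α) (hα1 : α ≤ 1) :
    B6.c1 dB δhi 1 ≤ B6.c1 dB δ α := by
  unfold B6.c1
  have h1 : 0 < α / 2 * δ := by positivity
  have hle : α / 2 * δ ≤ 1 / 2 * δhi := by nlinarith
  have hc : B6.c0 δhi (1 / 2) ≤ B6.c0 δ (α / 2) := c0_anti h1 hle
  have h0 : 0 ≤ B6.c0 δhi (1 / 2) := c0_nonneg _ _
  have hp : B6.c0 δhi (1 / 2) ^ dB ≤ B6.c0 δ (α / 2) ^ dB := pow_le_pow_left₀ h0 hc dB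
  linarith

/-- **One exponent for a whole window**: for δhi > 0 every real c is below `c₁(d′, δhi, 1)` for SOME d′ (n06-j's door
`exists_le_c1` at the corner), hence below `c₁(d′, δ, α)` on the whole window 0 < δ ≦ δhi, 0 < α ≦ 1 (`c1_window_le`).
[cite: Balaban1984PropagatorsII, Lemma 2.1 (2.61) p.234] -/
theorem exists_exp_window (c : ℝ) {δhi : ℝ} (hδhi : 0 < δhi) :
    ∃ dB : ℕ, ∀ δ α : ℝ, 0 < δ → δ ≤ δhi → 0 < α → α ≤ 1 → c ≤ B6.c1 dB δ α := by
  obtain ⟨dB, hdB⟩ := exists_le_c1 c (show 0 < (1 : ℝ) * δhi by simpa using hδhi)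
  exact ⟨dB, fun δ α hδ hδ' hα hα1 => hdB.trans (c1_window_le dB hδ hδ' hα hα1)⟩

end Arith

/-! ## §2 Over a family with the record schema `RowSum261`: one threshold ∕ one constant ∕ one exponent per window -/

section Family

variable {I : Type} (geo : I → B9.Geometry) [∀ i, Fintype (geo i).Site]

/-- ★ **(2.61) «ANTITONE IN THE RATE», WITH THE DEFINITE CONSTANT**: from `RowSum261 geo` and d ≧ 0, at every floor rate κlo > 0
there is ONE threshold M_L such that EVERY rate pair (δ, α) with κlo ≦ αδ has, on every member above M_L,
`Ineq261With (rowConst261 geo κlo) (toB6 (geo i) (R i) (H i)) δ α` — Σ_{y′} e^{−αδd(y,y′)} ≦ Σ_{y′} e^{−κlo·d(y,y′)} ≦ rowConst261 geo κlo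
(termwise; n06-j's `rowConst261_spec_of_rowSum261`); any transport letters `R`, `H`.
[cite: Balaban1984PropagatorsII, Lemma 2.1 (2.61) p.234 + (2.59) p.233] -/
theorem ineq261With_window_of_rowSum261 (R : I → ℝ) (H : I → Prop) (hrow : RowSum261 geo)
    (hd0 : ∀ (i : I) (y y' : (geo i).Site), 0 ≤ (geo i).dist y y') {κlo : ℝ} (hκlo : 0 < κlo) :
    ∃ ML : ℝ, ∀ (i : I) (δ α : ℝ), κlo ≤ α * δ → ML ≤ (geo i).M →
      Ineq261With (rowConst261 geo κlo) (toB6 (geo i) (R i) (H i)) δ α := by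
  obtain ⟨ML, h⟩ := rowConst261_spec_of_rowSum261 hrow hκlo
  refine ⟨ML, fun i δ α hκ hM y => ?_⟩
  refine le_trans (Finset.sum_le_sum fun y' _ => ?_) (h i hM y)
  show Real.exp (-(α * δ * (geo i).dist y y')) ≤ Real.exp (-(κlo * (geo i).dist y y'))
  rw [Real.exp_le_exp]
  have hd := hd0 i y y'
  nlinarith

/-- ★ **(2.61) IN PRINTED SHAPE, ONE EXPONENT AND ONE THRESHOLD FOR A CLOSED-BELOW RATE WINDOW**: from `RowSum261 geo` and d ≧ 0, for
every window 0 < δlo ≦ δ ≦ δhi, 0 < αlo ≦ α ≦ 1 there are an exponent dB and a threshold M_L with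
`Ineq261 dB (toB6 (geo i) (R i) (H i)) δ α` for every rate pair of the window and every member above M_L: the floor rate αlo·δlo
serves all (`ineq261With_window_of_rowSum261`), and `rowConst261 geo (αlo·δlo) ≦ c₁(dB, δ, α)` on the window (`exists_exp_window`).
[cite: Balaban1984PropagatorsII, Lemma 2.1 (2.61) p.234 + (2.59) p.233] -/
theorem ineq261_window_of_rowSum261 (R : I → ℝ) (H : I → Prop) (hrow : RowSum261 geo)
    (hd0 : ∀ (i : I) (y y' : (geo i).Site), 0 ≤ (geo i).dist y y') {δlo δhi αlo : ℝ} (hδlo : 0 < δlo)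
    (hδ : δlo ≤ δhi) (hαlo : 0 < αlo) :
    ∃ (dB : ℕ) (ML : ℝ), ∀ (i : I) (δ α : ℝ), δlo ≤ δ → δ ≤ δhi → αlo ≤ α → α ≤ 1 → ML ≤ (geo i).M →
      Ineq261 dB (toB6 (geo i) (R i) (H i)) δ α := by
  have hκlo : 0 < αlo * δlo := mul_pos hαlo hδlo
  obtain ⟨ML, h⟩ := ineq261With_window_of_rowSum261 geo R H hrow hd0 hκlo
  obtain ⟨dB, hdB⟩ := exists_exp_window (rowConst261 geo (αlo * δlo)) (lt_of_lt_of_le hδlo hδ)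
  refine ⟨dB, ML, fun i δ α h1 h2 h3 h4 hM => ?_⟩
  have hδ0 : 0 < δ := lt_of_lt_of_le hδlo h1
  have hα0 : 0 < α := lt_of_lt_of_le hαlo h3
  have hκ : αlo * δlo ≤ α * δ := mul_le_mul h3 h1 hδlo.le hα0.le
  exact B6RandomWalkHom.ineq261_of_rowSum_le (g := toB6 (geo i) (R i) (H i)) dB δ α _ (h i δ α hκ hM)
    (hdB δ α hδ0 h2 hα0 h4)

/-- ★ **(2.61) IN PRINTED SHAPE ON THE WINDOW OPEN AT 0: THE EXPONENT AND THE THRESHOLD AS FUNCTIONS OF THE RATE** (the frame-field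
shape `M261 δ ≦ (geo i).M → Ineq261 (d261 δ) …`): from `RowSum261 geo` and d ≧ 0, for every 0 < αlo ≦ 1 there are `d261 : ℝ → ℕ`
and `M261 : ℝ → ℝ` with `Ineq261 (d261 δ) (toB6 (geo i) (R i) (H i)) δ α` for every δ > 0, every αlo ≦ α ≦ 1 and every member above
`M261 δ` (choice over the one-rate windows of `ineq261_window_of_rowSum261`).  Lemma 2.1's *"RM sufficiently large"* depends on
the rate; so does the exponent here — a fixed exponent on the open window is not claimed.
[cite: Balaban1984PropagatorsII, Lemma 2.1 (2.61) p.234 + (2.59) p.233] -/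
theorem ineq261_fn_of_rowSum261 (R : I → ℝ) (H : I → Prop) (hrow : RowSum261 geo)
    (hd0 : ∀ (i : I) (y y' : (geo i).Site), 0 ≤ (geo i).dist y y') {αlo : ℝ} (hαlo : 0 < αlo) :
    ∃ (d261 : ℝ → ℕ) (M261 : ℝ → ℝ), ∀ (i : I) (δ α : ℝ), 0 < δ → αlo ≤ α → α ≤ 1 → M261 δ ≤ (geo i).M →
      Ineq261 (d261 δ) (toB6 (geo i) (R i) (H i)) δ α := by
  have key : ∀ δ : ℝ, ∃ (dB : ℕ) (ML : ℝ), 0 < δ → ∀ (i : I) (α : ℝ), αlo ≤ α → α ≤ 1 → ML ≤ (geo i).M →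
      Ineq261 dB (toB6 (geo i) (R i) (H i)) δ α := by
    intro δ
    by_cases hδ : 0 < δ
    · obtain ⟨dB, ML, h⟩ := ineq261_window_of_rowSum261 geo R H hrow hd0 hδ le_rfl hαlo
      exact ⟨dB, ML, fun _ i α h3 h4 hM => h i δ α le_rfl le_rfl h3 h4 hM⟩
    · exact ⟨0, 0, fun h' => absurd h' hδ⟩
  choose d261 M261 hspec using key
  exact ⟨d261, M261, fun i δ α hδ h3 h4 hM => hspec δ hδ i α h3 h4 hM⟩

/-- (2.61) in printed shape at TWO prescribed windows under one threshold and one exponent per window (e.g. Cor. 3.6's rate δ₀ and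
the sum's rate (1 − 2α)δ₀ with their own caps). [cite: Balaban1984PropagatorsII, Lemma 2.1 (2.61) p.234 + (2.59) p.233] -/
theorem ineq261_window_pair_of_rowSum261 (R : I → ℝ) (H : I → Prop) (hrow : RowSum261 geo)
    (hd0 : ∀ (i : I) (y y' : (geo i).Site), 0 ≤ (geo i).dist y y') {δlo δhi αlo δlo' δhi' αlo' : ℝ}
    (hδlo : 0 < δlo) (hδ : δlo ≤ δhi) (hαlo : 0 < αlo)
    (hδlo' : 0 < δlo') (hδ' : δlo' ≤ δhi') (hαlo' : 0 < αlo') :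
    ∃ (dB dB' : ℕ) (ML : ℝ), ∀ (i : I), ML ≤ (geo i).M →
      (∀ δ α : ℝ, δlo ≤ δ → δ ≤ δhi → αlo ≤ α → α ≤ 1 → Ineq261 dB (toB6 (geo i) (R i) (H i)) δ α) ∧
      (∀ δ α : ℝ, δlo' ≤ δ → δ ≤ δhi' → αlo' ≤ α → α ≤ 1 → Ineq261 dB' (toB6 (geo i) (R i) (H i)) δ α) := by
  obtain ⟨dB, ML, h⟩ := ineq261_window_of_rowSum261 geo R H hrow hd0 hδlo hδ hαlo
  obtain ⟨dB', ML', h'⟩ := ineq261_window_of_rowSum261 geo R H hrow hd0 hδlo' hδ' hαlo'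
  exact ⟨dB, dB', max ML ML', fun i hM =>
    ⟨fun δ α h1 h2 h3 h4 => h i δ α h1 h2 h3 h4 ((le_max_left _ _).trans hM),
     fun δ α h1 h2 h3 h4 => h' i δ α h1 h2 h3 h4 ((le_max_right _ _).trans hM)⟩⟩

end Family

/-! ## §3 At def-Y's members `geo9Y x`: the window data with NO hypothesis about the geometry -/

section StageY

variable {d ℓ : ℕ} {hd : 1 ≤ d + 1} {hL : Odd (ℓ + 1) ∧ 1 < ℓ + 1} {b₀ b₁ : ℝ} {Mstar : ℕ}

/-- `0 ≦ d(y, y′)` at a member (n06-i's `geo9K_dist_nonneg'`; `geo9Y x = geo9K x.toKIdx`).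
[cite: Balaban1984PropagatorsII, (2.46) p.231, bookkeeping] -/
theorem geo9Y_dist_nonneg (x : MemberY d ℓ hd hL b₀ b₁ Mstar) (y y' : (geo9Y x).Site) : 0 ≤ (geo9Y x).dist y y' :=
  geo9K_dist_nonneg' x.toKIdx y y'

/-- ★ **(2.60) THRESHOLD-FREE AT THE GEOMETRY OF RECORD**: for every transport letter `R x ≦ 2L² − 1` (L = ℓ + 1), every rate product
αδ ≧ 0 and every member, `Ineq260 (toB6 (geo9Y x) (R x) (H x)) δ α` — n06-i's level gap `levelGap_geo9Y` through n06-j's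
`ineq260_toB6_of_levelGap`; no M-threshold. [cite: Balaban1984PropagatorsII, Lemma 2.1 (2.60) p.234 + (2.2) p.224] -/
theorem ineq260_geo9Y_all (R : MemberY d ℓ hd hL b₀ b₁ Mstar → ℝ) (hR : ∀ x, R x ≤ 2 * ((ℓ : ℝ) + 1) ^ 2 - 1)
    (H : MemberY d ℓ hd hL b₀ b₁ Mstar → Prop) [∀ x : MemberY d ℓ hd hL b₀ b₁ Mstar, Fintype (geo9Y x).Site] :
    ∀ (x : MemberY d ℓ hd hL b₀ b₁ Mstar) (δ α : ℝ), 0 ≤ α * δ → Ineq260 (toB6 (geo9Y x) (R x) (H x)) δ α :=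
  fun x _ _ h => ineq260_toB6_of_levelGap (levelGap_geo9Y (hR x)) h (H x) x

variable [∀ x : MemberY d ℓ hd hL b₀ b₁ Mstar, Fintype (geo9Y x).Site]

/-- ★ **(2.61) «ANTITONE IN THE RATE» AT THE GEOMETRY OF RECORD, WITH THE DEFINITE CONSTANT**: for every floor rate κlo > 0 ONE threshold
with `Ineq261With (rowConst261 geo9Y κlo) (toB6 (geo9Y x) (R x) (H x)) δ α` for every rate pair κlo ≦ αδ and every member above it —
n06-i's `rowSum261_geo9Y` through §2. [cite: Balaban1984PropagatorsII, Lemma 2.1 (2.61) p.234 + (2.59) p.233] -/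
theorem ineq261With_window_geo9Y (R : MemberY d ℓ hd hL b₀ b₁ Mstar → ℝ) (H : MemberY d ℓ hd hL b₀ b₁ Mstar → Prop)
    {κlo : ℝ} (hκlo : 0 < κlo) :
    ∃ ML : ℝ, ∀ (x : MemberY d ℓ hd hL b₀ b₁ Mstar) (δ α : ℝ), κlo ≤ α * δ → ML ≤ (geo9Y x).M →
      Ineq261With (rowConst261 (@geo9Y d ℓ hd hL b₀ b₁ Mstar) κlo) (toB6 (geo9Y x) (R x) (H x)) δ α :=
  ineq261With_window_of_rowSum261 _ R H rowSum261_geo9Y geo9Y_dist_nonneg hκlo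

/-- ★★ **(2.61) IN PRINTED SHAPE AT THE GEOMETRY OF RECORD, ONE EXPONENT AND ONE THRESHOLD PER CLOSED-BELOW WINDOW**: for every window
0 < δlo ≦ δ ≦ δhi, 0 < αlo ≦ α ≦ 1 there are dB and M_L with `Ineq261 dB (toB6 (geo9Y x) (R x) (H x)) δ α` for every rate pair of the
window and every member above M_L — n06-i's `rowSum261_geo9Y` through §2; any transport letters.
[cite: Balaban1984PropagatorsII, Lemma 2.1 (2.61) p.234 + (2.59) p.233] -/
theorem ineq261_window_geo9Y (R : MemberY d ℓ hd hL b₀ b₁ Mstar → ℝ) (H : MemberY d ℓ hd hL b₀ b₁ Mstar → Prop)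
    {δlo δhi αlo : ℝ} (hδlo : 0 < δlo) (hδ : δlo ≤ δhi) (hαlo : 0 < αlo) :
    ∃ (dB : ℕ) (ML : ℝ), ∀ (x : MemberY d ℓ hd hL b₀ b₁ Mstar) (δ α : ℝ), δlo ≤ δ → δ ≤ δhi → αlo ≤ α → α ≤ 1 →
      ML ≤ (geo9Y x).M → Ineq261 dB (toB6 (geo9Y x) (R x) (H x)) δ α :=
  ineq261_window_of_rowSum261 _ R H rowSum261_geo9Y geo9Y_dist_nonneg hδlo hδ hαlo

/-- ★★ **(2.61) IN PRINTED SHAPE AT THE GEOMETRY OF RECORD, EXPONENT AND THRESHOLD AS FUNCTIONS OF THE RATE** (the frame-field shape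
`M261 δ ≦ M → Ineq261 (d261 δ) …` on the window open at 0): for every 0 < αlo ≦ 1 there are `d261 : ℝ → ℕ`, `M261 : ℝ → ℝ` with
`Ineq261 (d261 δ) (toB6 (geo9Y x) (R x) (H x)) δ α` for every δ > 0, αlo ≦ α ≦ 1 and every member above `M261 δ`.
[cite: Balaban1984PropagatorsII, Lemma 2.1 (2.61) p.234 + (2.59) p.233] -/
theorem ineq261_fn_geo9Y (R : MemberY d ℓ hd hL b₀ b₁ Mstar → ℝ) (H : MemberY d ℓ hd hL b₀ b₁ Mstar → Prop)
    {αlo : ℝ} (hαlo : 0 < αlo) :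
    ∃ (d261 : ℝ → ℕ) (M261 : ℝ → ℝ), ∀ (x : MemberY d ℓ hd hL b₀ b₁ Mstar) (δ α : ℝ), 0 < δ → αlo ≤ α → α ≤ 1 →
      M261 δ ≤ (geo9Y x).M → Ineq261 (d261 δ) (toB6 (geo9Y x) (R x) (H x)) δ α :=
  ineq261_fn_of_rowSum261 _ R H rowSum261_geo9Y geo9Y_dist_nonneg hαlo

/-- (2.61) at the geometry of record at TWO prescribed windows, one exponent each, one threshold.
[cite: Balaban1984PropagatorsII, Lemma 2.1 (2.61) p.234 + (2.59) p.233] -/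
theorem ineq261_window_pair_geo9Y (R : MemberY d ℓ hd hL b₀ b₁ Mstar → ℝ) (H : MemberY d ℓ hd hL b₀ b₁ Mstar → Prop)
    {δlo δhi αlo δlo' δhi' αlo' : ℝ} (hδlo : 0 < δlo) (hδ : δlo ≤ δhi) (hαlo : 0 < αlo)
    (hδlo' : 0 < δlo') (hδ' : δlo' ≤ δhi') (hαlo' : 0 < αlo') :
    ∃ (dB dB' : ℕ) (ML : ℝ), ∀ (x : MemberY d ℓ hd hL b₀ b₁ Mstar), ML ≤ (geo9Y x).M →
      (∀ δ α : ℝ, δlo ≤ δ → δ ≤ δhi → αlo ≤ α → α ≤ 1 → Ineq261 dB (toB6 (geo9Y x) (R x) (H x)) δ α) ∧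
      (∀ δ α : ℝ, δlo' ≤ δ → δ ≤ δhi' → αlo' ≤ α → α ≤ 1 → Ineq261 dB' (toB6 (geo9Y x) (R x) (H x)) δ α) :=
  ineq261_window_pair_of_rowSum261 _ R H rowSum261_geo9Y geo9Y_dist_nonneg hδlo hδ hαlo hδlo' hδ' hαlo'

/-- ★★ **[4] LEMMA 2.1 ON A CLOSED-BELOW RATE WINDOW AT THE GEOMETRY OF RECORD, R READ AS 1**: for every window 0 < δlo ≦ δ ≦ δhi,
0 < αlo ≦ α ≦ 1 there are ONE exponent dB and ONE threshold M_L such that every member above M_L has, for every rate pair of the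
window, (2.60) `Ineq260 (toB6 (geo9Y x) 1 (H x)) δ α` (threshold-free, `levelGap_geo9Y_one`) and (2.61)
`Ineq261 dB (toB6 (geo9Y x) 1 (H x)) δ α`. [cite: Balaban1984PropagatorsII, Lemma 2.1 (2.60)–(2.61) p.234 + (2.59) p.233] -/
theorem lemma21Window_geo9Y (H : MemberY d ℓ hd hL b₀ b₁ Mstar → Prop) {δlo δhi αlo : ℝ} (hδlo : 0 < δlo)
    (hδ : δlo ≤ δhi) (hαlo : 0 < αlo) :
    ∃ (dB : ℕ) (ML : ℝ), ∀ (x : MemberY d ℓ hd hL b₀ b₁ Mstar) (δ α : ℝ), δlo ≤ δ → δ ≤ δhi → αlo ≤ α → α ≤ 1 →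
      ML ≤ (geo9Y x).M →
        Ineq260 (toB6 (geo9Y x) 1 (H x)) δ α ∧ Ineq261 dB (toB6 (geo9Y x) 1 (H x)) δ α := by
  obtain ⟨dB, ML, h⟩ := ineq261_window_geo9Y (fun _ => (1 : ℝ)) H hδlo hδ hαlo
  refine ⟨dB, ML, fun x δ α h1 h2 h3 h4 hM => ⟨?_, h x δ α h1 h2 h3 h4 hM⟩⟩
  have hκ : 0 ≤ α * δ := mul_nonneg (hαlo.le.trans h3) (hδlo.le.trans h1)
  exact ineq260_toB6_of_levelGap levelGap_geo9Y_one hκ (H x) x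

end StageY

/-! ## §4 The p. 398 scale transfers on a rate window at the geometry of record -/

section Transfer

open Literature.MathematicalPhysics.QuantumFieldTheory.Balaban1983to89.B9Ineq347 (ScaleTransfer)
open Literature.MathematicalPhysics.QuantumFieldTheory.Balaban1983to89.B6Cor28 (TransferL)
open Literature.MathematicalPhysics.QuantumFieldTheory.Balaban1983to89.B9Ineq347Reading (geo9Y_L)

variable {g : B9.Geometry} {δ₀ α C C' : ℝ} {w w' : g.Site → ℝ}

/-- A scale transfer with constant C gives one with every larger constant, for nonnegative weights.
[cite: Balaban1985BackgroundPropagators, p.398 remark after (3.47), bookkeeping] -/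
theorem scaleTransfer_mono_const (hw : ∀ y, 0 ≤ w y) (hC : C ≤ C') (h : ScaleTransfer g δ₀ α C w) :
    ScaleTransfer g δ₀ α C' w :=
  fun y y' => (h y y').trans (mul_le_mul_of_nonneg_right hC (hw y))

/-- A scale transfer for a weight gives one for every pointwise-equal weight.
[cite: Balaban1985BackgroundPropagators, p.398 remark after (3.47), bookkeeping] -/
theorem scaleTransfer_congr (hww : ∀ y, w y = w' y) (h : ScaleTransfer g δ₀ α C w) : ScaleTransfer g δ₀ α C w' := by
  intro y y'
  rw [← hww y, ← hww y']
  exact h y y'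

variable {d ℓ : ℕ} {hd : 1 ≤ d + 1} {hL : Odd (ℓ + 1) ∧ 1 < ℓ + 1} {b₀ b₁ : ℝ} {Mstar : ℕ}

/-- **p. 398's SCALE TRANSFER AT THE GEOMETRY OF RECORD, EVERY REAL POWER, UNDER THE LOCATED SIZE CONDITION**: *"Using Lemma 2.1 in
[4] we may replace the factor (Lʲη)^α by (Lʲη)^β(L^{j′}η)^γ"* — at rate αδ > 0 and power q, every member with
`|q|·log L ≦ αδ·(2L² − 1)·M` has `ScaleTransfer (geo9Y x) δ α (L^{|q|}) (y ↦ (Lʲη)^q)`, i.e. `e^{−αδd(y,y′)}(L^{j′}η)^q ≦ L^{|q|}(Lʲη)^q`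
(n06-i's `transferL_geo9K` = `B6Cor28.transfer_of_260` on `ineq260_geo9K`).
[cite: Balaban1985BackgroundPropagators, p.398 remark after (3.47); Balaban1984PropagatorsII, Lemma 2.1 (2.60) p.234] -/
theorem scaleTransfer_rpow_geo9Y (x : MemberY d ℓ hd hL b₀ b₁ Mstar) {δ α : ℝ} (hε : 0 < α * δ) (q : ℝ)
    (hM : |q| * Real.log (geo9Y x).L ≤ α * δ * (2 * ((ℓ : ℝ) + 1) ^ 2 - 1) * (geo9Y x).M) :
    ScaleTransfer (geo9Y x) δ α ((geo9Y x).L ^ |q|) (fun y => (geo9Y x).len y ^ q) := by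
  intro y y'
  have h := transferL_geo9K x.toKIdx hε q hM y y'
  have hE : 0 < Real.exp (α * δ * (geo9Y x).dist y y') := Real.exp_pos _
  have hq0 : 0 ≤ (geo9Y x).L ^ |q| * (geo9Y x).len y ^ q :=
    mul_nonneg (Real.rpow_nonneg (zero_le_one.trans (geo9K_one_le_L x.toKIdx)) _)
      (Real.rpow_nonneg (geo9K_len_pos x.toKIdx y).le _)
  rw [Real.exp_neg, inv_mul_le_iff₀ hE]
  calc (geo9Y x).len y' ^ q ≤ (geo9Y x).L ^ |q| * Real.exp (α * δ * (geo9Y x).dist y y') * (geo9Y x).len y ^ q := h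
    _ = Real.exp (α * δ * (geo9Y x).dist y y') * ((geo9Y x).L ^ |q| * (geo9Y x).len y ^ q) := by ring

/-- **… ON A RATE WINDOW, ONE THRESHOLD AND ONE CONSTANT**: for every floor rate κlo > 0 and every power |q| ≦ 4, every member with
`4·log(ℓ + 1)∕κlo ≦ M` has, at EVERY rate pair with κlo ≦ αδ, `ScaleTransfer (geo9Y x) δ α ((ℓ + 1)⁴) (y ↦ (Lʲη)^q)` (L = ℓ + 1,
2L² − 1 ≧ 1, L^{|q|} ≦ L⁴). [cite: Balaban1985BackgroundPropagators, p.398 remark after (3.47); Balaban1984PropagatorsII, Lemma 2.1 (2.60) p.234] -/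
theorem scaleTransfer_rpow_window_geo9Y {κlo : ℝ} (hκlo : 0 < κlo) {q : ℝ} (hq : |q| ≤ 4)
    (x : MemberY d ℓ hd hL b₀ b₁ Mstar) {δ α : ℝ} (hκ : κlo ≤ α * δ)
    (hM : 4 * Real.log ((ℓ : ℝ) + 1) / κlo ≤ (geo9Y x).M) :
    ScaleTransfer (geo9Y x) δ α (((ℓ : ℝ) + 1) ^ 4) (fun y => (geo9Y x).len y ^ q) := by
  have hε : 0 < α * δ := lt_of_lt_of_le hκlo hκ
  have hLeq : (geo9Y x).L = (ℓ : ℝ) + 1 := by rw [geo9Y_L x]; push_cast; ring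
  have hL1 : 1 ≤ (geo9Y x).L := geo9K_one_le_L x.toKIdx
  have hM0 : 0 ≤ (geo9Y x).M := geo9K_M_nonneg x.toKIdx
  have hlog0 : 0 ≤ Real.log ((ℓ : ℝ) + 1) := Real.log_nonneg (by rw [← hLeq]; exact hL1)
  have hR1 : (1 : ℝ) ≤ 2 * ((ℓ : ℝ) + 1) ^ 2 - 1 := by nlinarith [(Nat.cast_nonneg ℓ : (0 : ℝ) ≤ ℓ)]
  -- the located size condition at this member from the window threshold
  have h4 : 4 * Real.log ((ℓ : ℝ) + 1) ≤ κlo * (geo9Y x).M := by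
    rw [div_le_iff₀ hκlo] at hM; linarith
  have hsize : |q| * Real.log (geo9Y x).L ≤ α * δ * (2 * ((ℓ : ℝ) + 1) ^ 2 - 1) * (geo9Y x).M := by
    rw [hLeq]
    calc |q| * Real.log ((ℓ : ℝ) + 1) ≤ 4 * Real.log ((ℓ : ℝ) + 1) := mul_le_mul_of_nonneg_right hq hlog0
      _ ≤ κlo * (geo9Y x).M := h4
      _ = κlo * 1 * (geo9Y x).M := by ring
      _ ≤ α * δ * (2 * ((ℓ : ℝ) + 1) ^ 2 - 1) * (geo9Y x).M :=
          mul_le_mul_of_nonneg_right (mul_le_mul hκ hR1 zero_le_one hε.le) hM0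
  have hT := scaleTransfer_rpow_geo9Y x hε q hsize
  -- enlarge the constant L^{|q|} ≦ L⁴ = (ℓ + 1)⁴
  have hC : (geo9Y x).L ^ |q| ≤ ((ℓ : ℝ) + 1) ^ 4 := by
    rw [hLeq]
    calc ((ℓ : ℝ) + 1) ^ |q| ≤ ((ℓ : ℝ) + 1) ^ (4 : ℝ) :=
          Real.rpow_le_rpow_of_exponent_le (by rw [← hLeq]; exact hL1) hq
      _ = ((ℓ : ℝ) + 1) ^ 4 := by norm_num
  exact scaleTransfer_mono_const (fun y => Real.rpow_nonneg (geo9K_len_pos x.toKIdx y).le _) hC hT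

/-- ★★ **THE SIX p. 398 SCALE TRANSFERS OF THE ROW-13 ∕ 18 ∕ 19 FRAMES ON A RATE WINDOW AT THE GEOMETRY OF RECORD** (the frames' field
`hST` for the weights Lʲη, (Lʲη)², (Lʲη)⁻¹, (Lʲη)⁻², (Lʲη)⁻⁴ and (Lʲη)^{−4} as a real power): for every floor rate κlo > 0, every member
with `4·log(ℓ + 1)∕κlo ≦ M` has all six at EVERY rate pair with κlo ≦ αδ, with the ONE constant (ℓ + 1)⁴ (`scaleTransfer_rpow_window_geo9Y`
at q = 1, 2, −1, −2, −4, −4; Lʲη > 0). [cite: Balaban1985BackgroundPropagators, p.398 remark after (3.47); Balaban1984PropagatorsII, Lemma 2.1 (2.60) p.234] -/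
theorem scaleTransfer6_window_geo9Y {κlo : ℝ} (hκlo : 0 < κlo) (x : MemberY d ℓ hd hL b₀ b₁ Mstar) {δ α : ℝ}
    (hκ : κlo ≤ α * δ) (hM : 4 * Real.log ((ℓ : ℝ) + 1) / κlo ≤ (geo9Y x).M) :
    ScaleTransfer (geo9Y x) δ α (((ℓ : ℝ) + 1) ^ 4) (fun a => (geo9Y x).len a) ∧
      ScaleTransfer (geo9Y x) δ α (((ℓ : ℝ) + 1) ^ 4) (fun a => (geo9Y x).len a ^ 2) ∧
      ScaleTransfer (geo9Y x) δ α (((ℓ : ℝ) + 1) ^ 4) (fun a => ((geo9Y x).len a)⁻¹) ∧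
      ScaleTransfer (geo9Y x) δ α (((ℓ : ℝ) + 1) ^ 4) (fun a => ((geo9Y x).len a ^ 2)⁻¹) ∧
      ScaleTransfer (geo9Y x) δ α (((ℓ : ℝ) + 1) ^ 4) (fun a => ((geo9Y x).len a ^ 4)⁻¹) ∧
      ScaleTransfer (geo9Y x) δ α (((ℓ : ℝ) + 1) ^ 4) (fun y => (geo9Y x).len y ^ (-(4 : ℝ))) := by
  have hpos : ∀ y, 0 < (geo9Y x).len y := fun y => geo9K_len_pos x.toKIdx y
  have T : ∀ q : ℝ, |q| ≤ 4 → ScaleTransfer (geo9Y x) δ α (((ℓ : ℝ) + 1) ^ 4) (fun y => (geo9Y x).len y ^ q) :=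
    fun q hq => scaleTransfer_rpow_window_geo9Y hκlo hq x hκ hM
  refine ⟨?_, ?_, ?_, ?_, ?_, T (-4) (by norm_num)⟩
  · exact scaleTransfer_congr (fun y => Real.rpow_one _) (T 1 (by norm_num))
  · exact scaleTransfer_congr (fun y => by rw [← Real.rpow_natCast]; norm_num) (T 2 (by norm_num))
  · exact scaleTransfer_congr (fun y => Real.rpow_neg_one _) (T (-1) (by norm_num))
  · exact scaleTransfer_congr (fun y => by
      rw [Real.rpow_neg (hpos y).le, ← Real.rpow_natCast]; norm_num) (T (-2) (by norm_num))
  · exact scaleTransfer_congr (fun y => by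
      rw [Real.rpow_neg (hpos y).le, ← Real.rpow_natCast]; norm_num) (T (-4) (by norm_num))

/-- ★★ **BOTH LEMMA-2.1 FRAME FIELDS ON A CLOSED-BELOW RATE WINDOW AT THE GEOMETRY OF RECORD, ONE THRESHOLD**: for every window
0 < δlo ≦ δ ≦ δhi, 0 < αlo ≦ α ≦ 1 there are ONE exponent dB and ONE threshold M_L such that every member above M_L has, at every
rate pair of the window, (2.61) `Ineq261 dB (toB6 (geo9Y x) (R x) (H x)) δ α` AND the six p. 398 scale transfers with constant (ℓ + 1)⁴
(any transport letters `R`, `H`: the row sums and the transfers read only 𝔅, d and Lʲη).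
[cite: Balaban1985BackgroundPropagators, p.398 remark after (3.47); Balaban1984PropagatorsII, Lemma 2.1 (2.60)–(2.61) p.234 + (2.59) p.233] -/
theorem lemma21Fields_window_geo9Y [∀ x : MemberY d ℓ hd hL b₀ b₁ Mstar, Fintype (geo9Y x).Site]
    (R : MemberY d ℓ hd hL b₀ b₁ Mstar → ℝ) (H : MemberY d ℓ hd hL b₀ b₁ Mstar → Prop)
    {δlo δhi αlo : ℝ} (hδlo : 0 < δlo) (hδ : δlo ≤ δhi) (hαlo : 0 < αlo) :
    ∃ (dB : ℕ) (ML : ℝ), ∀ (x : MemberY d ℓ hd hL b₀ b₁ Mstar) (δ α : ℝ), δlo ≤ δ → δ ≤ δhi → αlo ≤ α → α ≤ 1 →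
      ML ≤ (geo9Y x).M →
        Ineq261 dB (toB6 (geo9Y x) (R x) (H x)) δ α ∧
        (ScaleTransfer (geo9Y x) δ α (((ℓ : ℝ) + 1) ^ 4) (fun a => (geo9Y x).len a) ∧
          ScaleTransfer (geo9Y x) δ α (((ℓ : ℝ) + 1) ^ 4) (fun a => (geo9Y x).len a ^ 2) ∧
          ScaleTransfer (geo9Y x) δ α (((ℓ : ℝ) + 1) ^ 4) (fun a => ((geo9Y x).len a)⁻¹) ∧
          ScaleTransfer (geo9Y x) δ α (((ℓ : ℝ) + 1) ^ 4) (fun a => ((geo9Y x).len a ^ 2)⁻¹) ∧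
          ScaleTransfer (geo9Y x) δ α (((ℓ : ℝ) + 1) ^ 4) (fun a => ((geo9Y x).len a ^ 4)⁻¹) ∧
          ScaleTransfer (geo9Y x) δ α (((ℓ : ℝ) + 1) ^ 4) (fun y => (geo9Y x).len y ^ (-(4 : ℝ)))) := by
  have hκlo : 0 < αlo * δlo := mul_pos hαlo hδlo
  obtain ⟨dB, ML, h⟩ := ineq261_window_geo9Y R H hδlo hδ hαlo
  refine ⟨dB, max ML (4 * Real.log ((ℓ : ℝ) + 1) / (αlo * δlo)), fun x δ α h1 h2 h3 h4 hM => ⟨?_, ?_⟩⟩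
  · exact h x δ α h1 h2 h3 h4 ((le_max_left _ _).trans hM)
  · have hκ : αlo * δlo ≤ α * δ := mul_le_mul h3 h1 hδlo.le (hαlo.le.trans h3)
    exact scaleTransfer6_window_geo9Y hκlo x hκ ((le_max_right _ _).trans hM)

end Transfer

/-! ## §5 (v1.1, append-only) The row-13 frames' v2.1 Lemma-2.1 fields VERBATIM at the geometry of record

n06-c's frames v2.1 (`B9SectBGpStepAtLettersV2.GpFrame₂`, pub-ymgap INBOX 2026-08-27 l.≈16292) carry the two fields
`h261 : ∀ i δ α, 0 < δ → δ ≤ δcap → 9∕5000 ≤ α → α < 1 → M261 δ ≤ (geo i).M → Ineq261 (d261 δ) (toB6 (geo i) (Rr i) (Hp i)) δ α` and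
`hST : … MST δ ≤ (geo i).M → ⟨the six transfers⟩` with `Λf δ α := (ℓ+1)⁴`, `MST δ := 4·log(ℓ+1)∕((9∕5000)δ)`; here they are DISCHARGED at
`geo9Y` for any transport ∕ proviso letters `Rr`, `Hp` of the frame (corollaries of §3–§4 at αlo := 9∕5000). -/

section FramesV21

variable {d ℓ : ℕ} {hd : 1 ≤ d + 1} {hL : Odd (ℓ + 1) ∧ 1 < ℓ + 1} {b₀ b₁ : ℝ} {Mstar : ℕ}

open Literature.MathematicalPhysics.QuantumFieldTheory.Balaban1983to89.B9Ineq347 (ScaleTransfer)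

/-- ★★ **THE v2.1 FIELD `h261` OF THE ROW-13 FRAMES AT THE GEOMETRY OF RECORD**: there are `d261 : ℝ → ℕ` and `M261 : ℝ → ℝ` with
`Ineq261 (d261 δ) (toB6 (geo9Y x) (Rr x) (Hp x)) δ α` for every member above `M261 δ`, every `0 < δ ≤ δcap` and every `9∕5000 ≤ α < 1`
(`ineq261_fn_geo9Y` at αlo := 9∕5000; the cap and the strict upper bound only weaken the ask).
[cite: Balaban1984PropagatorsII, Lemma 2.1 (2.61) p.234 + (2.59) p.233] -/
theorem h261_frameV21_geo9Y [∀ x : MemberY d ℓ hd hL b₀ b₁ Mstar, Fintype (geo9Y x).Site]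
    (Rr : MemberY d ℓ hd hL b₀ b₁ Mstar → ℝ) (Hp : MemberY d ℓ hd hL b₀ b₁ Mstar → Prop) (δcap : ℝ) :
    ∃ (d261 : ℝ → ℕ) (M261 : ℝ → ℝ), ∀ (x : MemberY d ℓ hd hL b₀ b₁ Mstar) (δ α : ℝ), 0 < δ → δ ≤ δcap →
      9 / 5000 ≤ α → α < 1 → M261 δ ≤ (geo9Y x).M → Ineq261 (d261 δ) (toB6 (geo9Y x) (Rr x) (Hp x)) δ α := by
  obtain ⟨d261, M261, h⟩ := ineq261_fn_geo9Y (d := d) (ℓ := ℓ) (hd := hd) (hL := hL) (b₀ := b₀) (b₁ := b₁)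
    (Mstar := Mstar) Rr Hp (αlo := 9 / 5000) (by norm_num)
  exact ⟨d261, M261, fun x δ α hδ _ hα hα1 hM => h x δ α hδ hα hα1.le hM⟩

/-- ★★ **THE v2.1 FIELD `hST` OF THE ROW-13 FRAMES AT THE GEOMETRY OF RECORD** with `Λf δ α := (ℓ+1)⁴` and
`MST δ := 4·log(ℓ+1)∕((9∕5000)·δ)`: every member with `MST δ ≤ M` has the six p. 398 scale transfers at every `0 < δ`, `9∕5000 ≤ α`
(`scaleTransfer6_window_geo9Y` at the floor rate (9∕5000)·δ).
[cite: Balaban1985BackgroundPropagators, p.398 remark after (3.47); Balaban1984PropagatorsII, Lemma 2.1 (2.60) p.234] -/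
theorem hST_frameV21_geo9Y (x : MemberY d ℓ hd hL b₀ b₁ Mstar) {δ α : ℝ} (hδ : 0 < δ) (hα : 9 / 5000 ≤ α)
    (hM : 4 * Real.log ((ℓ : ℝ) + 1) / (9 / 5000 * δ) ≤ (geo9Y x).M) :
    ScaleTransfer (geo9Y x) δ α (((ℓ : ℝ) + 1) ^ 4) (fun a => (geo9Y x).len a) ∧
      ScaleTransfer (geo9Y x) δ α (((ℓ : ℝ) + 1) ^ 4) (fun a => (geo9Y x).len a ^ 2) ∧
      ScaleTransfer (geo9Y x) δ α (((ℓ : ℝ) + 1) ^ 4) (fun a => ((geo9Y x).len a)⁻¹) ∧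
      ScaleTransfer (geo9Y x) δ α (((ℓ : ℝ) + 1) ^ 4) (fun a => ((geo9Y x).len a ^ 2)⁻¹) ∧
      ScaleTransfer (geo9Y x) δ α (((ℓ : ℝ) + 1) ^ 4) (fun a => ((geo9Y x).len a ^ 4)⁻¹) ∧
      ScaleTransfer (geo9Y x) δ α (((ℓ : ℝ) + 1) ^ 4) (fun y => (geo9Y x).len y ^ (-(4 : ℝ))) :=
  scaleTransfer6_window_geo9Y (κlo := 9 / 5000 * δ) (by positivity) x (mul_le_mul_of_nonneg_right hα hδ.le) hM

end FramesV21

end Literature.MathematicalPhysics.QuantumFieldTheory.Balaban1983to89.B9RWSums347DefiniteFacesWindow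

end
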